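import Mathlib
import HarnessLib
import Summits.AtomisticToContinuum.Crystallization.Theorems.FrustratedLawDichotomyAperiodicFrustratedLawGapErgodicReduction
import Literature.Probability.Process.RootedHardCoreConfig

/-!
# Ergodic reduction for the crux `AperiodicFrustratedLawGap` — transfer along a kernel decomposition

Route `FrustratedLawDichotomy`, crux `AperiodicFrustratedLawGap` (item `stmt-AtomisticToContinuum-27623`),
registered stub `stub_ergodicReduction` (skeleton `dd3251ad731e`); sequel of
`FrustratedLawDichotomyAperiodicFrustratedLawGapErgodicReduction`.  There the stub was reduced
(`ergodicReduction_of_decomposition`) to a decomposition `P = join m` whose components are ALMOST ALL (for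
the law `m` on laws) point-stationary and ergodic.  The decomposition actually produced by conditioning
(`…ErgodicCondKernel`, `…ErgodicPullback`) is a KERNEL `ω ↦ F ω` on the configuration space with
`P = Q.bind F` and the properties holding for `Q`-almost every `ω` — which does not give the `join` form
(the property sets need not be measurable in the Giry σ-algebra of laws).  This file re-proves the transfer
in kernel form and restates the reduction accordingly:

* `exists_of_bind` — transfer of almost-sure clauses, null sets and `energy ≤ e⋆` to `F ω` for `Q`-almost
  every `ω`, for any measurable kernel `F` with `Q.bind F = P` whose values are almost surely
  point-stationary probability laws (energy step through the PROVED item-9229 lower bound `hLB`);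
* `ergodicReduction_of_kernelDecomposition` — the registered statement `S_ergodicReduction` VERBATIM from
  `hLB` and the kernel-form ergodic decomposition `hdec` (index space: the compact configuration space
  `RootedHardCoreConfig ℝ³ δ`; components `F ω`; `Q.bind F = P`; `Q`-a.e. component a point-stationary
  probability law trivial on the measurable re-rooting-invariant sets).

`[folklore]`.
-/

noncomputable section

namespace Summit.AtomisticToContinuum.Crystallization.Theorems.FrustratedLawDichotomyErgodicReduction

open MeasureTheory Set Filter
open scoped ENNReal
open Literature.MathematicalPhysics.StatisticalMechanics (lennardJones rootEnergy PeriodicConfiguration)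
open Literature.Probability.Process (IsRootedHardCore IsPointStationaryLaw LocalConfig)
open Literature.Probability.Process.LocalConfig (RootedHardCoreConfig)
open Summit.AtomisticToContinuum.Crystallization.Theses.PalmUnimodularRigidity (UnimodularEnergyLowerBound)

/-- Almost-sure properties pass through a kernel decomposition `Q.bind F = P` to the values `F ω` for
`Q`-almost every `ω`. [folklore] -/
theorem ae_ae_of_ae_bind {Ω α : Type*} [MeasurableSpace Ω] [MeasurableSpace α] {Q : Measure Ω}
    {F : Ω → Measure α} (hF : Measurable F) {p : α → Prop} (h : ∀ᵐ a ∂Q.bind F, p a) :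
    ∀ᵐ ω ∂Q, ∀ᵐ a ∂F ω, p a :=
  ae_of_ae_map hF.aemeasurable (Measure.ae_ae_of_ae_join h)

/-- **Transfer along a kernel decomposition.**  As `exists_of_join`, for a decomposition `P = Q.bind F`
by a measurable kernel `F` on any index space, `Q` a probability measure, whose values are `Q`-almost
surely point-stationary probability laws with a property `𝓔`: some value `F ω` is a probability law,
almost surely rooted `δ`-hard-core, point-stationary, with `𝓔`, with the almost-sure properties `p₁`,
`p₂` of `P`, giving measure `0` to the `P`-null set `S₃`, and with mean root energy `≤ e⋆`
(`= ⨅_Q e_LJ(Q)`), granted the energy lower bound `hLB` of item 9229. [folklore] -/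
theorem exists_of_bind (hLB : UnimodularEnergyLowerBound) {δ : ℝ} (hδ : 0 < δ)
    {P : Measure (Measure (EuclideanSpace ℝ (Fin 3)))} [IsProbabilityMeasure P]
    (hcore : ∀ᵐ μ ∂P, IsRootedHardCore δ μ) {p₁ p₂ : Measure (EuclideanSpace ℝ (Fin 3)) → Prop}
    (h₁ : ∀ᵐ μ ∂P, p₁ μ) (h₂ : ∀ᵐ μ ∂P, p₂ μ) {S₃ : Set (Measure (EuclideanSpace ℝ (Fin 3)))}
    (h₃ : P S₃ = 0)
    (hen : ∫ μ, rootEnergy lennardJones μ ∂P ≤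
      ⨅ Q : PeriodicConfiguration 3, Q.energyPerParticle lennardJones)
    {Ω : Type*} [MeasurableSpace Ω] {Q : Measure Ω} [IsProbabilityMeasure Q]
    {F : Ω → Measure (Measure (EuclideanSpace ℝ (Fin 3)))} (hF : Measurable F) (hbind : Q.bind F = P)
    {𝓔 : Measure (Measure (EuclideanSpace ℝ (Fin 3))) → Prop}
    (hcomp : ∀ᵐ ω ∂Q, IsProbabilityMeasure (F ω) ∧ IsPointStationaryLaw (F ω) ∧ 𝓔 (F ω)) :
    ∃ P' : Measure (Measure (EuclideanSpace ℝ (Fin 3))), IsProbabilityMeasure P' ∧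
      (∀ᵐ μ ∂P', IsRootedHardCore δ μ) ∧ IsPointStationaryLaw P' ∧ 𝓔 P' ∧ (∀ᵐ μ ∂P', p₁ μ) ∧
      (∀ᵐ μ ∂P', p₂ μ) ∧ P' S₃ = 0 ∧
      ∫ μ, rootEnergy lennardJones μ ∂P' ≤
        ⨅ Q : PeriodicConfiguration 3, Q.energyPerParticle lennardJones := by
  set e : ℝ := ⨅ Q : PeriodicConfiguration 3, Q.energyPerParticle lennardJones with he_def
  -- null sets and almost-sure properties pass to almost every component
  have hcore' : ∀ᵐ ω ∂Q, ∀ᵐ μ ∂F ω, IsRootedHardCore δ μ :=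
    ae_ae_of_ae_bind hF (by rw [hbind]; exact hcore)
  have h₁' : ∀ᵐ ω ∂Q, ∀ᵐ μ ∂F ω, p₁ μ := ae_ae_of_ae_bind hF (by rw [hbind]; exact h₁)
  have h₂' : ∀ᵐ ω ∂Q, ∀ᵐ μ ∂F ω, p₂ μ := ae_ae_of_ae_bind hF (by rw [hbind]; exact h₂)
  have h₃' : ∀ᵐ ω ∂Q, F ω S₃ = 0 := by
    have h : ∀ᵐ μ ∂Q.bind F, μ ∉ S₃ := by rw [hbind]; exact compl_mem_ae_iff.2 h₃
    exact (ae_ae_of_ae_bind hF h).mono fun ω hω => compl_mem_ae_iff.1 hω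
  -- the clamped measurable root energy and its nonnegative shift
  obtain ⟨B, hB0, G, hG, hGB, hGeq⟩ := exists_measurable_bounded_rootEnergy hδ
  set f : Measure (EuclideanSpace ℝ (Fin 3)) → ℝ≥0∞ := fun μ => ENNReal.ofReal (G μ + B) with hf_def
  have hf : Measurable f := ENNReal.measurable_ofReal.comp (hG.add_const B)
  set L : Measure (Measure (EuclideanSpace ℝ (Fin 3))) → ℝ≥0∞ := fun P' => ∫⁻ μ, f μ ∂P' with hL_def
  have hL : Measurable L := Measure.measurable_lintegral hf
  have hmean : ∀ (P' : Measure (Measure (EuclideanSpace ℝ (Fin 3)))), IsProbabilityMeasure P' →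
      (∀ᵐ μ ∂P', IsRootedHardCore δ μ) →
      ∫ μ, rootEnergy lennardJones μ ∂P' = (L P').toReal - B := by
    intro P' hP' hcP'
    rw [← integral_eq_toReal_lintegral_sub hG hGB]
    exact integral_congr_ae (hcP'.mono fun μ hμ => (hGeq μ hμ).symm)
  have hLfin : ∀ (P' : Measure (Measure (EuclideanSpace ℝ (Fin 3)))), IsProbabilityMeasure P' →
      L P' ≠ ∞ := fun P' hP' =>
    ((lintegral_ofReal_add_le (Q := P') hGB).trans_lt ENNReal.ofReal_lt_top).ne
  have hPmean : ∫ μ, rootEnergy lennardJones μ ∂P = (L P).toReal - B := hmean P inferInstance hcore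
  have heB : 0 ≤ e + B := by
    by_contra hlt
    have hlt' : e + B < 0 := lt_of_not_ge hlt
    have h0 : 0 ≤ (L P).toReal := ENNReal.toReal_nonneg
    rw [hPmean] at hen
    linarith
  -- lower bound on almost every component (item 9229)
  have hlow : ∀ᵐ ω ∂Q, ENNReal.ofReal (e + B) ≤ L (F ω) := by
    filter_upwards [hcomp, hcore'] with ω hω hcω
    obtain ⟨hprob, hstat, -⟩ := hω
    have hlb : e ≤ ∫ μ, rootEnergy lennardJones μ ∂F ω := hLB δ hδ (F ω) hprob hcω hstat
    rw [hmean (F ω) hprob hcω] at hlb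
    rw [ENNReal.ofReal_le_iff_le_toReal (hLfin (F ω) hprob)]
    linarith
  -- upper bound `∫ L (F ω) dQ = L P ≤ e + B`
  have hLP : L P = ∫⁻ ω, L (F ω) ∂Q := by
    simp only [hL_def]
    rw [← hbind]
    exact Measure.lintegral_bind hF.aemeasurable hf.aemeasurable
  have hup : ∫⁻ ω, L (F ω) ∂Q ≤ ENNReal.ofReal (e + B) := by
    rw [← hLP, ENNReal.le_ofReal_iff_toReal_le (hLfin P inferInstance) heB]
    rw [hPmean] at hen
    linarith
  have hle : ∀ᵐ ω ∂Q, L (F ω) ≤ ENNReal.ofReal (e + B) := by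
    have hmeasL : Measurable fun ω => L (F ω) := hL.comp hF
    have hsub : ∫⁻ ω, (L (F ω) - ENNReal.ofReal (e + B)) ∂Q = 0 := by
      rw [lintegral_sub measurable_const (by simp) hlow, lintegral_const, measure_univ, mul_one]
      exact tsub_eq_zero_of_le hup
    have hmeas : Measurable fun ω => L (F ω) - ENNReal.ofReal (e + B) := hmeasL.sub measurable_const
    rw [lintegral_eq_zero_iff hmeas] at hsub
    filter_upwards [hsub] with ω hω
    simpa only [Pi.zero_apply, tsub_eq_zero_iff_le] using hω
  -- pick a good index
  obtain ⟨ω, ⟨hprob, hstat, hE⟩, hcω, h1ω, h2ω, h3ω, hleω⟩ :=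
    (hcomp.and (hcore'.and (h₁'.and (h₂'.and (h₃'.and hle))))).exists
  refine ⟨F ω, hprob, hcω, hstat, hE, h1ω, h2ω, h3ω, ?_⟩
  rw [hmean (F ω) hprob hcω]
  have h := ENNReal.toReal_mono ENNReal.ofReal_ne_top hleω
  rw [ENNReal.toReal_ofReal heB] at h
  linarith

/-- **`S_ergodicReduction` from the kernel-form ergodic decomposition.**  The registered stub statement
VERBATIM, from the PROVED energy lower bound of item 9229 (`hLB`) and the one remaining input in the form
the conditioning construction delivers it (`hdec`): for every point-stationary probability law `P` on
rooted `δ`-hard-core configurations of `ℝ³` there are a probability measure `Q` on the configuration space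
`RootedHardCoreConfig ℝ³ δ` and a measurable kernel `F` into laws with `Q.bind F = P`, such that for
`Q`-almost every `ω` the law `F ω` is a point-stationary probability law trivial on every measurable
re-rooting-invariant set (take `Q` = the pull-back of `P`, `F ω` = the push-forward of the conditional
law `condExpKernel Q 𝓘 ω` given the invariant σ-algebra — steps D1–D4, D6 are in the companion files; the
a.e. ergodicity, step D5, is the open part). [folklore] -/
theorem ergodicReduction_of_kernelDecomposition (hLB : UnimodularEnergyLowerBound)
    (hdec : ∀ δ : ℝ, 0 < δ → ∀ P : MeasureTheory.Measure (MeasureTheory.Measure (EuclideanSpace ℝ (Fin 3))), MeasureTheory.IsProbabilityMeasure P → (∀ᵐ μ ∂P, Literature.Probability.Process.IsRootedHardCore δ μ) → Literature.Probability.Process.IsPointStationaryLaw P → ∃ Q : MeasureTheory.Measure (Literature.Probability.Process.LocalConfig.RootedHardCoreConfig (EuclideanSpace ℝ (Fin 3)) δ), MeasureTheory.IsProbabilityMeasure Q ∧ ∃ F : Literature.Probability.Process.LocalConfig.RootedHardCoreConfig (EuclideanSpace ℝ (Fin 3)) δ → MeasureTheory.Measure (MeasureTheory.Measure (EuclideanSpace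 ℝ (Fin 3))), Measurable F ∧ Q.bind F = P ∧ ∀ᵐ ω ∂Q, MeasureTheory.IsProbabilityMeasure (F ω) ∧ Literature.Probability.Process.IsPointStationaryLaw (F ω) ∧ (∀ A : Set (MeasureTheory.Measure (EuclideanSpace ℝ (Fin 3))), MeasurableSet A → (∀ μ : MeasureTheory.Measure (EuclideanSpace ℝ (Fin 3)), ∀ p : EuclideanSpace ℝ (Fin 3), μ {p} ≠ 0 → (μ ∈ A ↔ MeasureTheory.Measure.map (fun z : EuclideanSpace ℝ (Fin 3) => z - p) μ ∈ A)) → F ω A = 0 ∨ F ω Aᶜ = 0)) :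
    ∀ δ : ℝ, 0 < δ → ∀ P : MeasureTheory.Measure (MeasureTheory.Measure (EuclideanSpace ℝ (Fin 3))), let Gy : ℝ → (N : ℕ) → (Fin N → EuclideanSpace ℝ (Fin 3)) → Fin N → Prop := fun η N y j => let d : ℝ := sInf ((fun z => dist z (y (j : Fin N))) '' (Set.range (y) \ {(y (j : Fin N))})); let T : Set (EuclideanSpace ℝ (Fin 3)) := {z : EuclideanSpace ℝ (Fin 3) | z ∈ Set.range (y) ∧ z ≠ (y (j : Fin N)) ∧ dist z (y (j : Fin N)) < 13 / 10 * d}; ∃ A : EuclideanSpace ℝ (Fin 3) →ₗᵢ[ℝ] EuclideanSpace ℝ (Fin 3), (∃ e : ↥T ≃ ↥Literature.Geometry.DiscreteGeometry.fccKissingPattern, ∀ t : ↥T, dist (d⁻¹ • ((t : EuclideanSpace ℝ (Fin 3)) - (y (j : Fin N)))) (A ((e t : ↥Literature.Geometry.DiscreteGeometry.fccKissingPattern) : EuclideanSpace ℝ (Fin 3))) ≤ η) ∨ (∃ e : ↥T ≃ ↥Literature.Geometry.DiscreteGeometry.hcpKissingPattern, ∀ t : ↥T, dist (d⁻¹ •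 ((t : EuclideanSpace ℝ (Fin 3)) - (y (j : Fin N)))) (A ((e t : ↥Literature.Geometry.DiscreteGeometry.hcpKissingPattern) : EuclideanSpace ℝ (Fin 3))) ≤ η); let TexBall : (N : ℕ) → (Fin N → EuclideanSpace ℝ (Fin 3)) → Fin N → ℝ → ℝ → ℝ → ℝ → Prop := fun N y i R R₇ R₈ R₉ => (∀ a b : Fin N, a ≠ b → (7 : ℝ) / 10 ≤ dist (y a) (y b)) ∧ (∀ j : Fin N, dist (y j) (y i) ≤ R → ¬ Gy (1 / 20) N (y) j) ∧ (∀ j : Fin N, dist (y j) (y i) ≤ R → ¬ ((∀ j' : Fin N, dist (y j') (y j) ≤ R₇ → ¬ Gy (1 / 20) N (y) j') ∧ (∀ z : EuclideanSpace ℝ (Fin 3), dist z (y j) ≤ R₇ → ∃ k : Fin N, dist z (y k) ≤ 1) ∧ (∀ j' : Fin N, dist (y j') (y j) ≤ R₇ → (let d : ℝ := sInf ((fun z => dist z (y j')) '' (Set.range (y) \ {(y j')})); ∀ k : Fin N, y k ≠ y j' → dist (y k) (y j') < 27 / 20 * d → 5 ≤ Nat.card {m : Fin N // y m ≠ y j'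 ∧ dist (y m) (y j') < 27 / 20 * d ∧ y m ≠ y k ∧ dist (y m) (y k) < 27 / 20 * d})))) ∧ (∀ j : Fin N, dist (y j) (y i) ≤ R → ∃ k : Fin N, dist (y k) (y j) ≤ R₈ ∧ Gy (1 / 8) N (y) k) ∧ (∀ j : Fin N, dist (y j) (y i) ≤ R → ¬ ((∀ j' : Fin N, dist (y j') (y j) ≤ R₉ → ¬ Gy (1 / 20) N (y) j') ∧ (Nat.card {j' : Fin N // dist (y j') (y j) ≤ R₉ ∧ ¬ Gy (1 / 8) N (y) j'} : ℝ) ≤ 1 / 2 * (Nat.card {j' : Fin N // dist (y j') (y j) ≤ R₉} : ℝ) ∧ (∀ j' : Fin N, dist (y j') (y j) ≤ R₉ → ¬ Gy (1 / 8) N (y) j' → ¬ (let d : ℝ := sInf ((fun z => dist z (y j')) '' (Set.range (y) \ {(y j')})); ∀ k : Fin N, y k ≠ y j' → dist (y k) (y j') < 27 / 20 * d → 5 ≤ Nat.card {m : Fin N // y m ≠ y j' ∧ dist (y m) (y j') < 27 / 20 * d ∧ y m ≠ y k ∧ dist (y m) (y k) < 27 / 20 * d})))); let Appr : MeasureTheory.Measure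 (EuclideanSpace ℝ (Fin 3)) → ℝ → ℝ → ℝ → Prop := fun μ R₇ R₈ R₉ => ∀ q : EuclideanSpace ℝ (Fin 3), μ {q} ≠ 0 → ∀ R ε : ℝ, 0 < ε → ∃ (N : ℕ) (y : Fin N → EuclideanSpace ℝ (Fin 3)) (i : Fin N), TexBall N y i R R₇ R₈ R₉ ∧ (∀ p : EuclideanSpace ℝ (Fin 3), μ {p} ≠ 0 → dist p q ≤ R → ∃ k : Fin N, dist (y k - y i) (p - q) ≤ ε) ∧ (∀ k : Fin N, dist (y k) (y i) ≤ R → ∃ p : EuclideanSpace ℝ (Fin 3), μ {p} ≠ 0 ∧ dist (y k - y i) (p - q) ≤ ε); MeasureTheory.IsProbabilityMeasure P → (∀ᵐ μ ∂P, Literature.Probability.Process.IsRootedHardCore δ μ) → Literature.Probability.Process.IsPointStationaryLaw P → (∃ R₇ R₈ R₉ : ℝ, ∀ᵐ μ ∂P, Appr μ R₇ R₈ R₉) → (∀ᵐ μ ∂P, ∀ p : EuclideanSpace ℝ (Fin 3), μ {p} ≠ 0 → ∀ y : EuclideanSpace ℝ (Fin 3), (∀ q : EuclideanSpace ℝ (Fin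 3), μ {q} ≠ 0 → q ≠ p → y ≠ q) → ∑' q : {q : EuclideanSpace ℝ (Fin 3) // μ {q} ≠ 0 ∧ q ≠ p}, Literature.MathematicalPhysics.StatisticalMechanics.lennardJones (dist p (q : EuclideanSpace ℝ (Fin 3))) ≤ ∑' q : {q : EuclideanSpace ℝ (Fin 3) // μ {q} ≠ 0 ∧ q ≠ p}, Literature.MathematicalPhysics.StatisticalMechanics.lennardJones (dist y (q : EuclideanSpace ℝ (Fin 3)))) → P {μ : MeasureTheory.Measure (EuclideanSpace ℝ (Fin 3)) | ∃ Q : Literature.MathematicalPhysics.StatisticalMechanics.PeriodicConfiguration 3, ∃ t : EuclideanSpace ℝ (Fin 3), {p : EuclideanSpace ℝ (Fin 3) | μ {p} ≠ 0} = (fun s => s + t) '' Q.points} = 0 → (∫ μ, Literature.MathematicalPhysics.StatisticalMechanics.rootEnergy Literature.MathematicalPhysics.StatisticalMechanics.lennardJones μ ∂P) ≤ (⨅ Q : Literature.MathematicalPhysics.StatisticalMechanics.PeriodicConfiguration 3, Q.energyPerParticle Literature.MathematicalPhysics.StatisticalMechanics.lennardJones) → ∃ P' : MeasureTheory.Measure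 (MeasureTheory.Measure (EuclideanSpace ℝ (Fin 3))), MeasureTheory.IsProbabilityMeasure P' ∧ (∀ᵐ μ ∂P', Literature.Probability.Process.IsRootedHardCore δ μ) ∧ Literature.Probability.Process.IsPointStationaryLaw P' ∧ (∃ R₇ R₈ R₉ : ℝ, ∀ᵐ μ ∂P', Appr μ R₇ R₈ R₉) ∧ (∀ᵐ μ ∂P', ∀ p : EuclideanSpace ℝ (Fin 3), μ {p} ≠ 0 → ∀ y : EuclideanSpace ℝ (Fin 3), (∀ q : EuclideanSpace ℝ (Fin 3), μ {q} ≠ 0 → q ≠ p → y ≠ q) → ∑' q : {q : EuclideanSpace ℝ (Fin 3) // μ {q} ≠ 0 ∧ q ≠ p}, Literature.MathematicalPhysics.StatisticalMechanics.lennardJones (dist p (q : EuclideanSpace ℝ (Fin 3))) ≤ ∑' q : {q : EuclideanSpace ℝ (Fin 3) // μ {q} ≠ 0 ∧ q ≠ p}, Literature.MathematicalPhysics.StatisticalMechanics.lennardJones (dist y (q : EuclideanSpace ℝ (Fin 3)))) ∧ P' {μ : MeasureTheory.Measure (EuclideanSpace ℝ (Fin 3)) | ∃ Q : Literature.MathematicalPhysics.StatisticalMechanics.PeriodicConfiguration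 3, ∃ t : EuclideanSpace ℝ (Fin 3), {p : EuclideanSpace ℝ (Fin 3) | μ {p} ≠ 0} = (fun s => s + t) '' Q.points} = 0 ∧ (∫ μ, Literature.MathematicalPhysics.StatisticalMechanics.rootEnergy Literature.MathematicalPhysics.StatisticalMechanics.lennardJones μ ∂P') ≤ (⨅ Q : Literature.MathematicalPhysics.StatisticalMechanics.PeriodicConfiguration 3, Q.energyPerParticle Literature.MathematicalPhysics.StatisticalMechanics.lennardJones) ∧ (∀ A : Set (MeasureTheory.Measure (EuclideanSpace ℝ (Fin 3))), MeasurableSet A → (∀ μ : MeasureTheory.Measure (EuclideanSpace ℝ (Fin 3)), ∀ p : EuclideanSpace ℝ (Fin 3), μ {p} ≠ 0 → (μ ∈ A ↔ MeasureTheory.Measure.map (fun z : EuclideanSpace ℝ (Fin 3) => z - p) μ ∈ A)) → P' A = 0 ∨ P' Aᶜ = 0) := by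
  intro δ hδ P Gy TexBall Appr hP ha hb hd he h0 hen
  obtain ⟨R₇, R₈, R₉, hd'⟩ := hd
  obtain ⟨Q, hQ, F, hF, hbind, hcomp⟩ := hdec δ hδ P hP ha hb
  haveI := hP
  haveI := hQ
  obtain ⟨P', hprob, hcP', hstat, herg, h1, h2, h3, henP'⟩ :=
    exists_of_bind hLB hδ ha hd' he h0 hen hF hbind
      (𝓔 := (fun P' : MeasureTheory.Measure (MeasureTheory.Measure (EuclideanSpace ℝ (Fin 3))) => ∀ A : Set (MeasureTheory.Measure (EuclideanSpace ℝ (Fin 3))), MeasurableSet A → (∀ μ : MeasureTheory.Measure (EuclideanSpace ℝ (Fin 3)), ∀ p : EuclideanSpace ℝ (Fin 3), μ {p} ≠ 0 → (μ ∈ A ↔ MeasureTheory.Measure.map (fun z : EuclideanSpace ℝ (Fin 3) => z - p) μ ∈ A)) → P' A = 0 ∨ P' Aᶜ = 0))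
      hcomp
  exact ⟨P', hprob, hcP', hstat, ⟨R₇, R₈, R₉, h1⟩, h2, h3, henP', herg⟩

end Summit.AtomisticToContinuum.Crystallization.Theorems.FrustratedLawDichotomyErgodicReduction

end
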